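import Summits.BirchSwinnertonDyer.BirchSwinnertonDyer.Theorems.SignedLowerHalvesKobayashiLowerHalfLargeImageLambdaTwoStratumRankZero
import Literature.NumberTheory.EllipticCurves.Sprung2017.SharpFlatFunctionalEquationApZeroProofs
import HarnessLib

/-!
# Route `SignedLowerHalves`, crux 3 `KobayashiLowerHalfLargeImage` (item stmt-BirchSwinnertonDyer-19001):
# the `λ = 2` STRATUM, part 5 — the finite-Selmer branch at ANY ODD prime `p` (so at `p = 3`), with the
# ALGEBRAIC FUNCTIONAL EQUATION of `Sel^ε(E/ℚ_∞)` DISPLAYED PER PAIR instead of taken from B. D. Kim 2008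
# (printed for `p > 3` only) (cell `bsd-ssimc`, width seat `bsd-line-slh-p1-w6` gen 2; helper file
# `--supports 19001`; CALIBRATION / SUPPORT ONLY, pen rule D34-4 (3))

HONEST FRAMING: the crux and the line-of-record stub `KuriharaRigidity.stub_three` are OPEN and nothing
here proves them; BSD is not proved by any of this. THEOREMS ONLY, CONDITIONAL on DISPLAYED binders —
the PUBLISHED named facts Kobayashi 2003 Thm. 1.2 (`h12`) / Thm. 4.1 (`h41`), the period-unit facts
(`h5`, `h3`), Wuthrich 2014 Lemma 20 (`hL20`), B. D. Kim 2013 Cor. 3.15 (`hK13`), the `p`-parity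
theorem (`hpar`), GZK (`hGZK`) — and ONE per-pair algebraic hypothesis `hAFE`. Nothing is asserted about
any curve; nothing is booked.

## Why this file exists (the residue named by width seat `-w2` gen 6)

Parts 2–4 (`…LambdaTwoStratumMainConjecture` §4, `…Crux`, `…RankZero`, w2 g6, p652993/p653323/p653666)
close Kobayashi's main conjecture at a large-image pair with certificate `(μ, λ)(L_p^ε) = (0, 2)`,
`Sel_{p^∞}(E/ℚ)` finite and `p ∣ Tam(E)·#Sel_{p^∞}(E/ℚ)` — but only for `p ≥ 5`, because the one
non-elementary step (`λ(ξ^ε) ≠ 1`) consumes the ALGEBRAIC FUNCTIONAL EQUATION `ι(Char X^ε) = Char X^ε`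
through the tree's named fact `Kim2008.thm312_signedSelmerDual_charIdeal_map_invol`, typed `3 < p`
exactly as printed (B. D. Kim, MRL 15 (2008) p. 83: "let `p > 3` be a prime at which `E` has good
supersingular reduction"). At `p = 3` with `a_3 = 0` the same functional equation is EXPECTED (Lei–Ponsinet,
Ann. Math. Québec 41 (2017) §1 restate Kim's theorem for "`E` an elliptic curve with `a_p(E) = 0`", `p`
odd; their Thm. (main) is printed for `p` odd in the multi-signed language of Büyükboduk–Lei) but it is NOT
in print verbatim on Kobayashi's objects, so this file does NOT assert it: it is carried as the displayed
hypothesis `hAFE`, VERBATIM the body of Kim's fact at the pair `(W, p, ε)` with the clause `3 < p` removed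
(`afe_of_thm312`: at `p > 3` the named fact supplies it, so part 2 §4 is the special case). Everything
else in the proof is published at every odd `p`: Kato's divisibility `ξ^ε ∣ L_p^ε` under `p`-adic
surjectivity (Serre at `p ≥ 5`, Wuthrich's Lemma 20 at a good `3`), Kim 2013 Cor. 3.15 (`p` odd),
Pollack's functional equation (Sprung 2017 Cor. 4.14 at `a_p = 0`, DISCHARGED in the tree:
`Sprung2017.cor414_sharpFlat_functionalEquation_apZero_holds`), Dokchitser–Dokchitser `p`-parity.

## What this file does

* §1 `kobayashiMainConjecture_of_lam_eq_two_of_finite_of_dvd_of_afe` — ANY odd good `p`, `a_p = 0`,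
  `ρ̄_{E,p}` onto: certificate `(0, 2)` + `Sel_{p^∞}(E/ℚ)` finite + `p ∣ ∏ c_ℓ · #Sel_{p^∞}(E/ℚ)` + `hAFE`
  ⇒ `KobayashiMainConjecture W p ε` (proof = part 2 §4 word for word, the unit `v` with `ι ξ = v ξ` now
  read off `hAFE`); `afe_of_thm312` (the hypothesis from Kim's fact at `p > 3`); the `p ∣ Tam(E)` and
  `r_an = 0` (GZK) corollaries; the Eisenstein half.
* §2 both branches at any odd `p` (`…_of_imp_of_afe`: corank `≠ 0` by part 2 §3 + parity, NO `hAFE`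
  needed there; corank `0` by §1) and the crux's X7 shape `∃ ε, KobayashiLowerDivisibility W p ε`.
* Part 6 (`…LambdaTwoStratumOddPrimeThree.lean`, same seat) carries the X7 ∩ {`r_an = 0`} road to
  Miller's `BSDp W p` at odd `p` and the `p = 3` READINGS for the LEAD's ledger of `stub_three` (the
  `3 ∣ c_q` rows — where the `shadow-seed` population of the crux directory sits — and the records-level
  Mazur–Tate forms).

Populations / what is NOT done: the `p = 3` one-element converse rows (`3 ∤ Tam·#Sel`) and `λ ≥ 3` are not
touched; `hAFE` at `p = 3` is a TYPING REQUEST (Kim 2008 Thm. 3.12 in MAX form `p` odd ∧ `a_p = 0`, or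
Lei–Ponsinet 2017 Thm. (main) ∘ the Büyükboduk–Lei/Kobayashi identification, or Matar 2020 Thm. 1.1),
not a theorem of the tree.

References: [Kobayashi2003] Thm. 1.2, Thm. 4.1, Conjecture (p. 2), (3.6); [KimBD2008MRL] Thm. 3.12, p. 83;
[LeiPonsinet2017] §1, Thm. (main), Thm. 6.1; [BDKim2013] Cor. 3.15; [Sprung2017] Cor. 4.14;
[DokchitserDokchitserAnnals2010] Thm. 1.4; [Wuthrich2014] Lemma 20, Prop. 21; [Darmon2004] Thm. 3.22;
[Pollack2003] Prop. 6.9, 6.10, 6.18; [GreenbergLNM1716] §1, §5 p. 181; [GreenbergVatsal2000] p. 4;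
[SilvermanAEC2009] Cor. VII.6.2; [Miller2011LMS] Def. 1.1. Crux dir: `K1G17-SEARCH-LOG.md` §4,
`K1G18-SEARCH-LOG.md` (shadow census), `Lines/shadow_seed.lean`, `LineReportKuriharaRigidity.md` v9.
-/

set_option autoImplicit false
set_option linter.dupNamespace false

noncomputable section

open scoped Classical MatrixGroups ModularForm

open CongruenceSubgroup PowerSeries WeierstrassCurve Literature.NumberTheory.EllipticCurves
  Literature.NumberTheory.EllipticCurves.ModularForms Literature.Barriers.BirchSwinnertonDyer
  Literature.NumberTheory.EllipticCurves.Rank1Residual Literature.NumberTheory.EllipticCurves.Sprung2017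
  Literature.NumberTheory.EllipticCurves.Kobayashi2003 ZpExtension
  Literature.NumberTheory.EllipticCurves.Rank1Residual.Typed
  Summit.BirchSwinnertonDyer.Rank1Residual Summit.BirchSwinnertonDyer.Rank1Residual.X1.MuLambda
  Summit.BirchSwinnertonDyer.Rank1Residual.Supersingular
  Summit.BirchSwinnertonDyer.BirchSwinnertonDyer.Theorems.LargeImageParityStratum

namespace Summit.BirchSwinnertonDyer.BirchSwinnertonDyer.Theorems.LargeImageLambdaTwoStratum

/-! ## §1. The finite-Selmer branch at any odd `p`, the algebraic functional equation displayed -/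

section FiniteSelmerOdd

variable (W : WeierstrassCurve ℚ) [W.IsElliptic] [W.IsGloballyMinimal] (p : ℕ) [Fact p.Prime]

omit [Fact p.Prime] in
/-- **The displayed hypothesis `hAFE` at `p > 3` IS Kim's theorem.** For `p > 3` good with `a_p = 0`,
B. D. Kim 2008 Thm. 3.12 at `K = ℚ` (`Kim2008.thm312_signedSelmerDual_charIdeal_map_invol`, named fact,
PUBLISHED) gives, for every cyclotomic `κ` with topological generator `γ` and every dual datum `D` of
`Sel^ε(E/ℚ_∞)`, `ι(Char X^ε) = Char X^ε` — i.e. exactly the per-pair hypothesis carried by the theorems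
of this file. So at `p ≥ 5` they specialise to parts 2–4. [cite: KimBD2008MRL, Thm. 3.12 (p. 93) and §1 p. 83] -/
theorem afe_of_thm312 [Fact p.Prime] (hK08 : Kim2008.thm312_signedSelmerDual_charIdeal_map_invol)
    (hp3 : 3 < p) (hgood : W.HasGoodReductionAtPrime p) (hap : W.frobeniusTrace p = 0) (ε : ℤˣ) :
    ∀ (κ : ZpExtension ℚ p) (γ : Field.absoluteGaloisGroup ℚ), κ.IsCyclotomic → κ.IsTopGenerator γ →
      ∀ D : SignedSelmerDualData W κ γ ε,
        Ideal.map (IwasawaAlgebra.invol p) D.charIdeal = D.charIdeal :=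
  fun κ γ hκ hγ D ↦ hK08 W p hp3 hgood hap κ γ hκ hγ ε D

/-- **Kobayashi's main conjecture for `(E, p, ε)` at a pair with certificate `(μ, λ)(L_p^ε) = (0, 2)`,
`Sel_{p^∞}(E/ℚ)` FINITE and `p ∣ ∏_ℓ c_ℓ · #Sel_{p^∞}(E/ℚ)`, at ANY odd good `p` with `a_p = 0` and
`ρ̄_{E,p}` onto, GRANTED the algebraic functional equation AT THE PAIR** (`hAFE`: for every cyclotomic
`κ`, topological generator `γ` and dual datum `D` of `Sel^ε(E/ℚ_∞)`, `ι(Char X^ε) = Char X^ε` — verbatim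
the body of B. D. Kim 2008 Thm. 3.12 at `(W, p, ε)`; supplied by the named fact when `p > 3`,
`afe_of_thm312`; a HYPOTHESIS at `p = 3`) and, BY NAME, Kobayashi Thm. 1.2 (`h12`), Thm. 4.1 (`h41`, the
Kato side `ξ^ε ∣ L_p^ε` under `p`-adic surjectivity: Serre at `p ≥ 5`, Wuthrich's Lemma 20 `hL20` at a
good `3`), the period-unit facts (`h5`, `h3`) and B. D. Kim 2013 Cor. 3.15 (`hK13`, `p` odd:
`ξ^ε(0) = u · p^{ord_p ∏ c_ℓ} · #Sel_{p^∞}(E/ℚ)`). Proof (= part 2 §4): `ξ ∣ L_p^ε` gives `μ(ξ) = 0`,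
`λ(ξ) ≤ 2`; `λ(ξ) = 0` would make `ξ` a unit, but `p ∣ ξ(0)`; `λ(ξ) = 1` would give `ξ(0) = 0` by
part 1 §1 (`constantCoeff_eq_zero_of_subst_eq_mul`) applied to `ι ξ = v ξ` (from `hAFE`), but
`ξ(0) ≠ 0`; so `λ(ξ) = 2 = λ(L_p^ε)` and `(ξ) = (L_p^ε)`. PER PAIR in `hcert₀`/`hfin`/`hdvd`/`hAFE`;
CONDITIONAL on the displayed binders. [cite: Kobayashi2003, Thm. 1.2 (p. 2), Thm. 4.1 (p. 8) and Conjecture (p. 2)]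
[cite: KimBD2008MRL, §1 p. 83 ("(a) = (a^ι)") and Thm. 3.12 (p. 93)] [cite: BDKim2013, Cor. 3.15 (p. 199)]
[cite: GreenbergLNM1716, §5 (p. 181)] [cite: GreenbergVatsal2000, p. 4] [cite: Wuthrich2014, Lemma 20 (p. 399)] -/
theorem kobayashiMainConjecture_of_lam_eq_two_of_finite_of_dvd_of_afe
    (h12 : Kobayashi2003.thm12_signedSelmerDual_finite_torsion)
    (h41 : Kobayashi2003.thm41_signedCharIdeal_divisibility)
    (h5 : realPeriodRat_eq_unit_mul_plusPeriod) (h3 : realPeriodRat_eq_unit_mul_plusPeriod_three)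
    (hL20 : Wuthrich2014.lemma20_surjective_threeAdic_of_semistable)
    (hK13 : BDKim2013.cor315_signedCharValue_rankZero)
    (hp : p ≠ 2) (hgood : W.HasGoodReductionAtPrime p) (hap : W.frobeniusTrace p = 0)
    (hs : Surj W p) (ε : ℤˣ)
    (hAFE : ∀ (κ : ZpExtension ℚ p) (γ : Field.absoluteGaloisGroup ℚ), κ.IsCyclotomic →
      κ.IsTopGenerator γ → ∀ D : SignedSelmerDualData W κ γ ε,
        Ideal.map (IwasawaAlgebra.invol p) D.charIdeal = D.charIdeal)
    [NeZero (W.conductorNorm ℤ)] {f₀ : CuspForm (Gamma0 (W.conductorNorm ℤ)) 2} (hf₀ : IsNewformOf W f₀)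
    (hcert₀ : ∀ L : IwasawaAlgebra p, IsSignedPAdicLFunction f₀ p ε L → mu L = 0 ∧ lam L = 2)
    (hfin : Finite (W.selmerGroupPInfty p))
    (hdvd : p ∣ W.tamagawaProduct * Nat.card (W.selmerGroupPInfty p)) :
    KobayashiMainConjecture W p ε := by
  have hpP : p.Prime := Fact.out
  intro κ γ hκ hγ hγ' _ f hf ϖ hϖ Lplus Lminus hPP D
  have hff : f = f₀ := hf.unique hf₀
  subst hff
  haveI : Module.Finite (IwasawaAlgebra p) D.X := h12.moduleFinite hp hgood hap hκ hγ D
  have hX : Module.IsTorsion (IwasawaAlgebra p) D.X := h12.isTorsion hp hgood hap hκ hγ D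
  refine ⟨hX, ?_⟩
  obtain ⟨ξ, hξ⟩ := (charIdeal_isPrincipal_holds p D.X).principal
  have hξ' : D.charIdeal = Ideal.span {ξ} := hξ
  set L := kobayashiL ε Lplus Lminus with hL_def
  have hL : IsSignedPAdicLFunction f p ε L := hPP.isSignedPAdicLFunction_kobayashiL ε
  have hL0 : L ≠ 0 := kobayashiL_ne_zero p hPP ε
  -- (MC↑), integral: `ξ ∣ L`; hence `μ(ξ) = 0`
  have hsurj : ∀ m : ℕ, W.HasSurjectiveModNGaloisRep (p ^ m : ℕ) :=
    surjective_pow_of_surj_of_good W p hL20 hp hgood hs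
  have hU : ξ ∣ L := h41.dvd_of_charIdeal_eq_span hp hgood hap hf hκ hγ hγ' hL D hX hsurj hξ'
  obtain ⟨hμ, hlam⟩ := hcert₀ L hL
  obtain ⟨h, hh⟩ := hU
  have hξ0 : ξ ≠ 0 := fun h0 ↦ hL0 (by rw [hh, h0, zero_mul])
  have hh0 : h ≠ 0 := fun h0 ↦ hL0 (by rw [hh, h0, mul_zero])
  have hμξ : mu ξ = 0 := by
    have hle := mu_le_mu_mul hξ0 hh0
    rw [← hh, hμ] at hle
    exact Nat.le_zero.mp hle
  -- `ξ(0) ≠ 0` and `p ∣ ξ(0)` (Kim 2013 Cor. 3.15 + the divisibility bit)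
  have hc0ne : constantCoeff ξ ≠ 0 :=
    BDKim2013.cor315_signedCharValue_rankZero.constantCoeff_ne_zero hK13 hp hgood hap hκ hγ D hX hξ' hfin
  have hc0dvd : (p : ℤ_[p]) ∣ constantCoeff ξ := by
    obtain ⟨u, hu⟩ := hK13 W p hp hgood hap κ γ hκ hγ ε D hX ξ hξ' hfin
    have hu' : constantCoeff ξ = (u : ℤ_[p]) * (p : ℤ_[p]) ^ padicValNat p W.tamagawaProduct *
        (Nat.card (W.selmerGroupPInfty p) : ℤ_[p]) := by
      refine PadicInt.ext ?_
      push_cast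
      exact hu
    rw [hu']
    rcases hpP.dvd_mul.mp hdvd with ht | hc
    · have ht1 : 1 ≤ padicValNat p W.tamagawaProduct :=
        one_le_padicValNat_of_dvd (W.tamagawaProduct_pos').ne' ht
      exact Dvd.dvd.mul_right (Dvd.dvd.mul_left (dvd_pow_self _ (by omega)) _) _
    · exact Dvd.dvd.mul_left (Nat.cast_dvd_cast hc) _
  -- the algebraic functional equation AT THE PAIR, generator form: `ι ξ = v ξ` with `v ∈ Λˣ`
  have hgen : ∃ v : (IwasawaAlgebra p)ˣ, IwasawaAlgebra.invol p ξ = (v : IwasawaAlgebra p) * ξ := by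
    have hmap := hAFE κ γ hκ hγ D
    rw [hξ', Ideal.map_span, Set.image_singleton] at hmap
    obtain ⟨v, hv⟩ := Ideal.span_singleton_eq_span_singleton.mp hmap.symm
    exact ⟨v, by rw [← hv, mul_comm]⟩
  -- `λ(ξ) ≥ 2`: `λ(ξ) = 0` ⇒ unit, `λ(ξ) = 1` ⇒ `ξ(0) = 0` by the algebraic functional equation
  have hlamξ : 2 ≤ lam ξ := by
    by_contra hlt
    rcases Nat.le_one_iff_eq_zero_or_eq_one.mp (Nat.lt_succ_iff.mp (not_le.mp hlt)) with hl | hl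
    · have hunit : IsUnit ξ := (isUnit_iff_mu_eq_zero_and_lam_eq_zero ξ).mpr ⟨hξ0, hμξ, hl⟩
      exact not_isUnit_of_dvd hc0dvd (PowerSeries.isUnit_iff_constantCoeff.mp hunit)
    · obtain ⟨v, hv⟩ := hgen
      rw [IwasawaAlgebra.invol_apply] at hv
      have hι : (1 + X : IwasawaAlgebra p) * (IwasawaAlgebra.invSubOne p + 1) = 1 := by
        rw [add_comm (IwasawaAlgebra.invSubOne p) 1]
        exact IwasawaAlgebra.one_add_X_mul_one_add_invSubOne p
      have h1 : ¬ (p : ℤ_[p]) ∣ coeff 1 ξ := by rw [← hl]; exact not_dvd_coeff_lam hξ0 hμξ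
      exact hc0ne (constantCoeff_eq_zero_of_subst_eq_mul hp hι hc0dvd h1 hv)
  have hspan : Ideal.span ({ξ} : Set (IwasawaAlgebra p)) = Ideal.span {L} :=
    span_eq_span_of_dvd_of_lam_le hL0 ⟨h, hh⟩ hμ (by rw [hlam]; exact hlamξ)
  exact exists_generator_of_span_eq W p h5 h3 hp hgood hap hf hϖ hξ' hspan

/-- **Sanity: at `p ≥ 5` the displayed-AFE theorem IS part 2 §4** — feeding `afe_of_thm312` into
`kobayashiMainConjecture_of_lam_eq_two_of_finite_of_dvd_of_afe` returns the statement of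
`kobayashiMainConjecture_of_lam_eq_two_of_finite_of_dvd` (p652993), so nothing is lost by displaying
the functional equation. [cite: KimBD2008MRL, Thm. 3.12 (p. 93)] [cite: Kobayashi2003, Conjecture (p. 2)] -/
theorem kobayashiMainConjecture_of_lam_eq_two_of_finite_of_dvd_of_thm312
    (h12 : Kobayashi2003.thm12_signedSelmerDual_finite_torsion)
    (h41 : Kobayashi2003.thm41_signedCharIdeal_divisibility)
    (h5 : realPeriodRat_eq_unit_mul_plusPeriod) (h3 : realPeriodRat_eq_unit_mul_plusPeriod_three)
    (hL20 : Wuthrich2014.lemma20_surjective_threeAdic_of_semistable)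
    (hK08 : Kim2008.thm312_signedSelmerDual_charIdeal_map_invol)
    (hK13 : BDKim2013.cor315_signedCharValue_rankZero)
    (hp3 : 3 < p) (hgood : W.HasGoodReductionAtPrime p) (hap : W.frobeniusTrace p = 0)
    (hs : Surj W p) (ε : ℤˣ)
    [NeZero (W.conductorNorm ℤ)] {f₀ : CuspForm (Gamma0 (W.conductorNorm ℤ)) 2} (hf₀ : IsNewformOf W f₀)
    (hcert₀ : ∀ L : IwasawaAlgebra p, IsSignedPAdicLFunction f₀ p ε L → mu L = 0 ∧ lam L = 2)
    (hfin : Finite (W.selmerGroupPInfty p))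
    (hdvd : p ∣ W.tamagawaProduct * Nat.card (W.selmerGroupPInfty p)) :
    KobayashiMainConjecture W p ε :=
  kobayashiMainConjecture_of_lam_eq_two_of_finite_of_dvd_of_afe W p h12 h41 h5 h3 hL20 hK13 (by omega)
    hgood hap hs ε (afe_of_thm312 W p hK08 hp3 hgood hap ε) hf₀ hcert₀ hfin hdvd

/-- **Corollary — the `p ∣ Tam(E)` rows at any odd `p`**: certificate `(0, 2)`, `Sel_{p^∞}(E/ℚ)` finite,
`p ∣ ∏_ℓ c_ℓ`, and `hAFE` at the pair ⇒ Kobayashi's main conjecture for `(E, p, ε)` (odd good `p`,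
`a_p = 0`, `ρ̄` onto; binders as in §1). At `p = 3` the divisibility `3 ∣ ∏ c_ℓ` is met by EVERY curve
with an additive prime of Kodaira type `IV` or `IV*` and `c_q = 3` (the non-split shadow primes of the
crux directory's `shadow-seed` line) and by every split multiplicative `ℓ` with `3 ∣ ord_ℓ(Δ)`.
[cite: Kobayashi2003, Thm. 1.2, Thm. 4.1 and Conjecture (p. 2)] [cite: BDKim2013, Cor. 3.15 (p. 199)]
[cite: KimBD2008MRL, Thm. 3.12 (p. 93)] -/
theorem kobayashiMainConjecture_of_lam_eq_two_of_finite_of_dvd_tamagawa_of_afe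
    (h12 : Kobayashi2003.thm12_signedSelmerDual_finite_torsion)
    (h41 : Kobayashi2003.thm41_signedCharIdeal_divisibility)
    (h5 : realPeriodRat_eq_unit_mul_plusPeriod) (h3 : realPeriodRat_eq_unit_mul_plusPeriod_three)
    (hL20 : Wuthrich2014.lemma20_surjective_threeAdic_of_semistable)
    (hK13 : BDKim2013.cor315_signedCharValue_rankZero)
    (hp : p ≠ 2) (hgood : W.HasGoodReductionAtPrime p) (hap : W.frobeniusTrace p = 0)
    (hs : Surj W p) (ε : ℤˣ)
    (hAFE : ∀ (κ : ZpExtension ℚ p) (γ : Field.absoluteGaloisGroup ℚ), κ.IsCyclotomic →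
      κ.IsTopGenerator γ → ∀ D : SignedSelmerDualData W κ γ ε,
        Ideal.map (IwasawaAlgebra.invol p) D.charIdeal = D.charIdeal)
    [NeZero (W.conductorNorm ℤ)] {f₀ : CuspForm (Gamma0 (W.conductorNorm ℤ)) 2} (hf₀ : IsNewformOf W f₀)
    (hcert₀ : ∀ L : IwasawaAlgebra p, IsSignedPAdicLFunction f₀ p ε L → mu L = 0 ∧ lam L = 2)
    (hfin : Finite (W.selmerGroupPInfty p)) (hdvd : p ∣ W.tamagawaProduct) :
    KobayashiMainConjecture W p ε :=
  kobayashiMainConjecture_of_lam_eq_two_of_finite_of_dvd_of_afe W p h12 h41 h5 h3 hL20 hK13 hp hgood hap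
    hs ε hAFE hf₀ hcert₀ hfin (Dvd.dvd.mul_right hdvd _)

/-- **Corollary — ANALYTIC RANK `0`, `p ∣ Tam(E)`, any odd `p`**: `Sel_{p^∞}(E/ℚ)` is finite by
Gross–Zagier–Kolyvagin (`hGZK`, part 4's `finite_selmerGroupPInfty_of_analyticRank_eq_zero`), so §1
applies with the per-pair inputs `h0 : r_an = 0`, `hdvd : p ∣ ∏ c_ℓ`, the certificate, and `hAFE`.
[cite: Kobayashi2003, Thm. 1.2, Thm. 4.1 and Conjecture (p. 2)] [cite: Darmon2004, Thm. 3.22]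
[cite: BDKim2013, Cor. 3.15 (p. 199)] [cite: KimBD2008MRL, Thm. 3.12 (p. 93)] -/
theorem kobayashiMainConjecture_of_lam_eq_two_of_dvd_tamagawa_of_analyticRank_eq_zero_of_afe
    (h12 : Kobayashi2003.thm12_signedSelmerDual_finite_torsion)
    (h41 : Kobayashi2003.thm41_signedCharIdeal_divisibility)
    (h5 : realPeriodRat_eq_unit_mul_plusPeriod) (h3 : realPeriodRat_eq_unit_mul_plusPeriod_three)
    (hL20 : Wuthrich2014.lemma20_surjective_threeAdic_of_semistable)
    (hK13 : BDKim2013.cor315_signedCharValue_rankZero)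
    (hGZK : rank_eq_analyticRank_of_analyticRank_le_one)
    (hp : p ≠ 2) (hgood : W.HasGoodReductionAtPrime p) (hap : W.frobeniusTrace p = 0)
    (hs : Surj W p) (ε : ℤˣ)
    (hAFE : ∀ (κ : ZpExtension ℚ p) (γ : Field.absoluteGaloisGroup ℚ), κ.IsCyclotomic →
      κ.IsTopGenerator γ → ∀ D : SignedSelmerDualData W κ γ ε,
        Ideal.map (IwasawaAlgebra.invol p) D.charIdeal = D.charIdeal)
    [NeZero (W.conductorNorm ℤ)] {f₀ : CuspForm (Gamma0 (W.conductorNorm ℤ)) 2} (hf₀ : IsNewformOf W f₀)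
    (hcert₀ : ∀ L : IwasawaAlgebra p, IsSignedPAdicLFunction f₀ p ε L → mu L = 0 ∧ lam L = 2)
    (h0 : W.analyticRank = 0) (hdvd : p ∣ W.tamagawaProduct) :
    KobayashiMainConjecture W p ε :=
  kobayashiMainConjecture_of_lam_eq_two_of_finite_of_dvd_tamagawa_of_afe W p h12 h41 h5 h3 hL20 hK13 hp
    hgood hap hs ε hAFE hf₀ hcert₀ (finite_selmerGroupPInfty_of_analyticRank_eq_zero W p hGZK h0) hdvd

/-- **The Eisenstein half `KobayashiLowerDivisibility W p ε` on the finite-Selmer branch, any odd `p`**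
(binders of §1; `h = 1`). [cite: Kobayashi2003, Conjecture (Main Conjecture) (p. 2)] -/
theorem kobayashiLowerDivisibility_of_lam_eq_two_of_finite_of_dvd_of_afe
    (h12 : Kobayashi2003.thm12_signedSelmerDual_finite_torsion)
    (h41 : Kobayashi2003.thm41_signedCharIdeal_divisibility)
    (h5 : realPeriodRat_eq_unit_mul_plusPeriod) (h3 : realPeriodRat_eq_unit_mul_plusPeriod_three)
    (hL20 : Wuthrich2014.lemma20_surjective_threeAdic_of_semistable)
    (hK13 : BDKim2013.cor315_signedCharValue_rankZero)
    (hp : p ≠ 2) (hgood : W.HasGoodReductionAtPrime p) (hap : W.frobeniusTrace p = 0)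
    (hs : Surj W p) (ε : ℤˣ)
    (hAFE : ∀ (κ : ZpExtension ℚ p) (γ : Field.absoluteGaloisGroup ℚ), κ.IsCyclotomic →
      κ.IsTopGenerator γ → ∀ D : SignedSelmerDualData W κ γ ε,
        Ideal.map (IwasawaAlgebra.invol p) D.charIdeal = D.charIdeal)
    [NeZero (W.conductorNorm ℤ)] {f₀ : CuspForm (Gamma0 (W.conductorNorm ℤ)) 2} (hf₀ : IsNewformOf W f₀)
    (hcert₀ : ∀ L : IwasawaAlgebra p, IsSignedPAdicLFunction f₀ p ε L → mu L = 0 ∧ lam L = 2)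
    (hfin : Finite (W.selmerGroupPInfty p))
    (hdvd : p ∣ W.tamagawaProduct * Nat.card (W.selmerGroupPInfty p)) :
    KobayashiLowerDivisibility W p ε :=
  kobayashiLowerDivisibility_of_mainConjecture
    (kobayashiMainConjecture_of_lam_eq_two_of_finite_of_dvd_of_afe W p h12 h41 h5 h3 hL20 hK13 hp hgood
      hap hs ε hAFE hf₀ hcert₀ hfin hdvd)

end FiniteSelmerOdd

/-! ## §2. Both branches at any odd `p`; the crux's X7 shape; `BSD(E,p)` on X7 ∩ {`r_an = 0`} -/

section BothBranchesOdd

variable (W : WeierstrassCurve ℚ) [W.IsElliptic] [W.IsGloballyMinimal] (p : ℕ) [Fact p.Prime]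

/-- **On the `λ = 2` stratum, at ANY odd good `p` with `a_p = 0` and `ρ̄` onto, Kobayashi's main
conjecture for `(E, p, ε)` holds UNLESS `Sel_{p^∞}(E/ℚ)` is finite with `p ∤ ∏ c_ℓ · #Sel_{p^∞}(E/ℚ)`
— GRANTED the algebraic functional equation at the pair (`hAFE`, used on the finite branch only).**
Branch «corank `≠ 0`» = part 2 §3 (`…_of_selmerCorank_ne_zero`, any odd `p`: parity `hpar` + Pollack's
functional equation, the latter a tree THEOREM `Sprung2017.cor414_sharpFlat_functionalEquation_apZero_holds`,
so no `hFE` binder here); branch «corank `0`» = §1 (`Sel_{p^∞}` is then finite: `p`-primary,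
cofinitely generated, corank `0`). [cite: Kobayashi2003, Thm. 1.2, Thm. 4.1 and Conjecture (p. 2)]
[cite: KimBD2008MRL, Thm. 3.12 (p. 93)] [cite: BDKim2013, Cor. 3.15 (p. 199)]
[cite: DokchitserDokchitserAnnals2010, Thm. 1.4] [cite: Sprung2017, Cor. 4.14 (a_p = 0 display)] -/
theorem kobayashiMainConjecture_of_lam_eq_two_of_imp_of_afe
    (h12 : Kobayashi2003.thm12_signedSelmerDual_finite_torsion)
    (h41 : Kobayashi2003.thm41_signedCharIdeal_divisibility)
    (h5 : realPeriodRat_eq_unit_mul_plusPeriod) (h3 : realPeriodRat_eq_unit_mul_plusPeriod_three)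
    (hL20 : Wuthrich2014.lemma20_surjective_threeAdic_of_semistable)
    (hK13 : BDKim2013.cor315_signedCharValue_rankZero)
    (hpar : p_parity W p)
    (hp : p ≠ 2) (hgood : W.HasGoodReductionAtPrime p) (hap : W.frobeniusTrace p = 0)
    (hs : Surj W p) (ε : ℤˣ)
    (hAFE : ∀ (κ : ZpExtension ℚ p) (γ : Field.absoluteGaloisGroup ℚ), κ.IsCyclotomic →
      κ.IsTopGenerator γ → ∀ D : SignedSelmerDualData W κ γ ε,
        Ideal.map (IwasawaAlgebra.invol p) D.charIdeal = D.charIdeal)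
    [NeZero (W.conductorNorm ℤ)] {f₀ : CuspForm (Gamma0 (W.conductorNorm ℤ)) 2} (hf₀ : IsNewformOf W f₀)
    (hcert₀ : ∀ L : IwasawaAlgebra p, IsSignedPAdicLFunction f₀ p ε L → mu L = 0 ∧ lam L = 2)
    (hres : Finite (W.selmerGroupPInfty p) → p ∣ W.tamagawaProduct * Nat.card (W.selmerGroupPInfty p)) :
    KobayashiMainConjecture W p ε := by
  by_cases h0 : W.selmerCorank p = 0
  · -- corank `0`: the `p`-primary, cofinitely generated Selmer group is finite
    have hfin : Finite (W.selmerGroupPInfty p) := by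
      have hprim : ∀ x : W.selmerGroupPInfty p, ∃ k : ℕ, p ^ k • x = 0 := fun x ↦ by
        obtain ⟨k, hk⟩ := exists_pow_nsmul_eq_zero_galH1Primary W p (x : galH1Primary W p)
        exact ⟨k, Subtype.ext (by rw [AddSubmonoidClass.coe_nsmul, hk, ZeroMemClass.coe_zero])⟩
      haveI : Finite (AddSubgroup.torsionBy (W.selmerGroupPInfty p) (p : ℤ)) :=
        W.finite_torsionBy_selmerGroupPInfty
      exact finite_of_zpCorank_eq_zero p hprim h0
    exact kobayashiMainConjecture_of_lam_eq_two_of_finite_of_dvd_of_afe W p h12 h41 h5 h3 hL20 hK13 hp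
      hgood hap hs ε hAFE hf₀ hcert₀ hfin (hres hfin)
  · exact kobayashiMainConjecture_of_lam_eq_two_of_selmerCorank_ne_zero W p h12 h41 h5 h3 hL20 hpar
      cor414_sharpFlat_functionalEquation_apZero_holds hp hgood hap hs ε hf₀ hcert₀ h0

/-- **The Eisenstein half on the `λ = 2` stratum, both branches, any odd `p`** (binders of
`kobayashiMainConjecture_of_lam_eq_two_of_imp_of_afe`). [cite: Kobayashi2003, Conjecture (Main Conjecture) (p. 2)] -/
theorem kobayashiLowerDivisibility_of_lam_eq_two_of_imp_of_afe
    (h12 : Kobayashi2003.thm12_signedSelmerDual_finite_torsion)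
    (h41 : Kobayashi2003.thm41_signedCharIdeal_divisibility)
    (h5 : realPeriodRat_eq_unit_mul_plusPeriod) (h3 : realPeriodRat_eq_unit_mul_plusPeriod_three)
    (hL20 : Wuthrich2014.lemma20_surjective_threeAdic_of_semistable)
    (hK13 : BDKim2013.cor315_signedCharValue_rankZero)
    (hpar : p_parity W p)
    (hp : p ≠ 2) (hgood : W.HasGoodReductionAtPrime p) (hap : W.frobeniusTrace p = 0)
    (hs : Surj W p) (ε : ℤˣ)
    (hAFE : ∀ (κ : ZpExtension ℚ p) (γ : Field.absoluteGaloisGroup ℚ), κ.IsCyclotomic →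
      κ.IsTopGenerator γ → ∀ D : SignedSelmerDualData W κ γ ε,
        Ideal.map (IwasawaAlgebra.invol p) D.charIdeal = D.charIdeal)
    [NeZero (W.conductorNorm ℤ)] {f₀ : CuspForm (Gamma0 (W.conductorNorm ℤ)) 2} (hf₀ : IsNewformOf W f₀)
    (hcert₀ : ∀ L : IwasawaAlgebra p, IsSignedPAdicLFunction f₀ p ε L → mu L = 0 ∧ lam L = 2)
    (hres : Finite (W.selmerGroupPInfty p) → p ∣ W.tamagawaProduct * Nat.card (W.selmerGroupPInfty p)) :
    KobayashiLowerDivisibility W p ε :=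
  kobayashiLowerDivisibility_of_mainConjecture
    (kobayashiMainConjecture_of_lam_eq_two_of_imp_of_afe W p h12 h41 h5 h3 hL20 hK13 hpar hp hgood hap hs
      ε hAFE hf₀ hcert₀ hres)

/-- **The crux's conclusion `∃ ε, KobayashiLowerDivisibility W p ε` AT AN X7 PAIR on the `λ = 2`
stratum, any odd `p`** — binder list of the crux (`ClassX7`, `¬CM` idle, `a_p = 0`, `Surj`) + the
per-pair data (certificate `(0, 2)` for ONE sign `ε`, the residual bit `hres`, `hAFE` at `(E, p, ε)`) +
the PUBLISHED named facts. The witness is the certified sign. PER PAIR; not a class theorem; the crux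
untouched. [cite: Kobayashi2003, Conjecture (Main Conjecture) (p. 2)] [cite: KimBD2008MRL, Thm. 3.12 (p. 93)] -/
theorem X7.exists_kobayashiLowerDivisibility_of_lam_eq_two_of_imp_of_afe
    (h12 : Kobayashi2003.thm12_signedSelmerDual_finite_torsion)
    (h41 : Kobayashi2003.thm41_signedCharIdeal_divisibility)
    (h5 : realPeriodRat_eq_unit_mul_plusPeriod) (h3 : realPeriodRat_eq_unit_mul_plusPeriod_three)
    (hL20 : Wuthrich2014.lemma20_surjective_threeAdic_of_semistable)
    (hK13 : BDKim2013.cor315_signedCharValue_rankZero)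
    (hpar : p_parity W p)
    (hp : p ≠ 2) (hX : ClassX7 W p) (_hCM : ¬ W.HasCM) (hap : W.frobeniusTrace p = 0) (hs : Surj W p)
    [NeZero (W.conductorNorm ℤ)] {f₀ : CuspForm (Gamma0 (W.conductorNorm ℤ)) 2} (hf₀ : IsNewformOf W f₀)
    {ε : ℤˣ} (hcert₀ : ∀ L : IwasawaAlgebra p, IsSignedPAdicLFunction f₀ p ε L → mu L = 0 ∧ lam L = 2)
    (hAFE : ∀ (κ : ZpExtension ℚ p) (γ : Field.absoluteGaloisGroup ℚ), κ.IsCyclotomic →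
      κ.IsTopGenerator γ → ∀ D : SignedSelmerDualData W κ γ ε,
        Ideal.map (IwasawaAlgebra.invol p) D.charIdeal = D.charIdeal)
    (hres : Finite (W.selmerGroupPInfty p) → p ∣ W.tamagawaProduct * Nat.card (W.selmerGroupPInfty p)) :
    ∃ ε : ℤˣ, KobayashiLowerDivisibility W p ε :=
  ⟨ε, kobayashiLowerDivisibility_of_lam_eq_two_of_imp_of_afe W p h12 h41 h5 h3 hL20 hK13 hpar hp hX.1.1
    hap hs ε hAFE hf₀ hcert₀ hres⟩

end BothBranchesOdd

end Summit.BirchSwinnertonDyer.BirchSwinnertonDyer.Theorems.LargeImageLambdaTwoStratum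

end
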